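import Mathlib
import HarnessLib

/-!
# Route `KLProgramme` — crux K3 ENGINE (stmt-…-20437) stub (b) conj. 2 «(c-D)² FAMILY TELESCOPE», brick (D5-prep): the increment pair's difference bounds
# `𝔅₁, 𝔅₂, 𝔅₃` RELATIVE to its amplitude `𝔅₀ = C₁W₀` — every `W_k` is `≤ ω_k·W₀`, hence `𝔅_k ≤ 𝔅₀·ρ_k` with explicit `ρ_k`

Cell `gate-hubbard-kl`, seat hubbard-kl-k3c3-p2 (g10); F1-DESIGN §10 («the one new arithmetic piece» of the per-term wiring).  The sampled increment-pair lemmas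
(p582397/p585208/p589294) bound the differences by `𝔅`-Leibniz expressions with `𝔅₀ = C₁W₀`, `𝔅₁ = C₂W₀(D₁+W₁) + C₁W₁`, … (`W₀ = P₀(2E₀+P₀)`,
`W₁ = 2(E₁P₀ + E₀P₁ + P₀P₁)`, …); the pair lemma is applied to the multiplier divided by its amplitude `A = 𝔅₀` (`normalisedMultiplier_data`), so the rate class (D3)
needs the RELATIVE sizes.  Here, for `E₀, P₀ > 0` and nonnegative data:

* `incrPair_W_rel_le` — `W₁ ≤ ω₁W₀`, `W₂ ≤ ω₂W₀`, `W₃ ≤ ω₃W₀` with `ω₁ = E₁/E₀ + 2P₁/P₀`, `ω₂ = E₂/E₀ + 2E₁P₁/(E₀P₀) + 2P₂/P₀ + P₁²/(E₀P₀)`,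
  `ω₃ = E₃/E₀ + 3E₂P₁/(E₀P₀) + 3E₁P₂/(E₀P₀) + 2P₃/P₀ + 3P₁P₂/(E₀P₀)` (in the two-scale class `P_k/P₀ = (G_k/G₀)x^k‖w‖^k`: degree `k` in `x`);
* **`incrPair_B_rel_le`** — with `C₂ = κC₁`, `C₃ = κ²C₁`, `C₄ = κ³C₁` (`κ = e₀²/Λ²`): `𝔅₁ ≤ 𝔅₀·(κ(D₁+W₁) + ω₁)`,
  `𝔅₂ ≤ 𝔅₀·(κ²(D₁+W₁)² + κω₁(2D₁+W₁) + κ(D₂+W₂) + ω₂)`,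
  `𝔅₃ ≤ 𝔅₀·(κ³(D₁+W₁)³ + κ²ω₁(3D₁²+3D₁W₁+W₁²) + 3(κ²(D₁+W₁)(D₂+W₂) + κ(D₁ω₂ + ω₁D₂ + ω₁W₂)) + κ(D₃+W₃) + ω₃)`.

Pure real algebra; no definitions, no sorry.  Nothing asserts superconductivity. [cite: BenfattoGiulianiMastropietro2006, §3 (3.2)–(3.8)]
-/

noncomputable section

namespace Summit.HubbardSuperconductivity.HubbardSuperconductivity.Theorems.TorusFourierL2

set_option linter.dupNamespace false -- summit = problem name (single-conjunct summit), D-0017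

/-- **The piece brackets relative to `W₀`**: `W₁ ≤ ω₁W₀`, `W₂ ≤ ω₂W₀`, `W₃ ≤ ω₃W₀` (see the module docstring). [cite: BenfattoGiulianiMastropietro2006, §3 (3.2)] -/
theorem incrPair_W_rel_le {E₀ E₁ E₂ E₃ P₀ P₁ P₂ P₃ W₀ W₁ W₂ W₃ ω₁ ω₂ ω₃ : ℝ} (hE₀ : 0 < E₀) (hP₀ : 0 < P₀)
    (hE₁ : 0 ≤ E₁) (hE₂ : 0 ≤ E₂) (hE₃ : 0 ≤ E₃) (hP₁ : 0 ≤ P₁) (hP₂ : 0 ≤ P₂) (hP₃ : 0 ≤ P₃)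
    (hW₀ : W₀ = P₀ * (2 * E₀ + P₀)) (hW₁ : W₁ = 2 * (E₁ * P₀ + E₀ * P₁ + P₀ * P₁))
    (hW₂ : W₂ = 2 * (E₂ * P₀ + 2 * E₁ * P₁ + E₀ * P₂ + P₁ ^ 2 + P₀ * P₂))
    (hW₃ : W₃ = 2 * (E₃ * P₀ + 3 * E₂ * P₁ + 3 * E₁ * P₂ + E₀ * P₃ + 3 * P₁ * P₂ + P₀ * P₃))
    (hω₁ : ω₁ = E₁ / E₀ + 2 * P₁ / P₀) (hω₂ : ω₂ = E₂ / E₀ + 2 * E₁ * P₁ / (E₀ * P₀) + 2 * P₂ / P₀ + P₁ ^ 2 / (E₀ * P₀))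
    (hω₃ : ω₃ = E₃ / E₀ + 3 * E₂ * P₁ / (E₀ * P₀) + 3 * E₁ * P₂ / (E₀ * P₀) + 2 * P₃ / P₀ + 3 * P₁ * P₂ / (E₀ * P₀)) :
    W₁ ≤ ω₁ * W₀ ∧ W₂ ≤ ω₂ * W₀ ∧ W₃ ≤ ω₃ * W₀ := by
  have hE0 := hE₀.ne'
  have hP0 := hP₀.ne'
  refine ⟨?_, ?_, ?_⟩
  · have key : ω₁ * W₀ = 2 * (E₁ * P₀) + E₁ * P₀ ^ 2 / E₀ + 4 * (E₀ * P₁) + 2 * (P₀ * P₁) := by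
      rw [hω₁, hW₀]; field_simp; ring
    have h1 : 0 ≤ E₁ * P₀ ^ 2 / E₀ := by positivity
    have h2 : 0 ≤ E₀ * P₁ := by positivity
    rw [key, hW₁]; linarith
  · have key : ω₂ * W₀ = 2 * (E₂ * P₀) + E₂ * P₀ ^ 2 / E₀ + 4 * (E₁ * P₁) + 2 * (E₁ * P₁ * P₀) / E₀ + 4 * (E₀ * P₂) + 2 * (P₀ * P₂) +
        2 * P₁ ^ 2 + P₁ ^ 2 * P₀ / E₀ := by
      rw [hω₂, hW₀]; field_simp; ring
    have h1 : 0 ≤ E₂ * P₀ ^ 2 / E₀ := by positivity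
    have h2 : 0 ≤ 2 * (E₁ * P₁ * P₀) / E₀ := by positivity
    have h3 : 0 ≤ E₀ * P₂ := by positivity
    have h4 : 0 ≤ P₁ ^ 2 * P₀ / E₀ := by positivity
    rw [key, hW₂]; linarith
  · have key : ω₃ * W₀ = 2 * (E₃ * P₀) + E₃ * P₀ ^ 2 / E₀ + 6 * (E₂ * P₁) + 3 * (E₂ * P₁ * P₀) / E₀ + 6 * (E₁ * P₂) + 3 * (E₁ * P₂ * P₀) / E₀ +
        4 * (E₀ * P₃) + 2 * (P₀ * P₃) + 6 * (P₁ * P₂) + 3 * (P₁ * P₂ * P₀) / E₀ := by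
      rw [hω₃, hW₀]; field_simp; ring
    have h1 : 0 ≤ E₃ * P₀ ^ 2 / E₀ := by positivity
    have h2 : 0 ≤ 3 * (E₂ * P₁ * P₀) / E₀ := by positivity
    have h3 : 0 ≤ 3 * (E₁ * P₂ * P₀) / E₀ := by positivity
    have h4 : 0 ≤ E₀ * P₃ := by positivity
    have h5 : 0 ≤ 3 * (P₁ * P₂ * P₀) / E₀ := by positivity
    rw [key, hW₃]; linarith

set_option maxHeartbeats 800000 in
/-- **The increment pair's difference bounds relative to its amplitude**: `𝔅_k ≤ 𝔅₀·ρ_k` (see the module docstring), from `W_k ≤ ω_kW₀` and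
`C_{k+1} = κ^k C₁`. [cite: BenfattoGiulianiMastropietro2006, §3 (3.2)–(3.8)] -/
theorem incrPair_B_rel_le {κ C₁ C₂ C₃ C₄ D₁ D₂ D₃ W₀ W₁ W₂ W₃ ω₁ ω₂ ω₃ B₀ B₁ B₂ B₃ : ℝ} (hκ : 0 ≤ κ) (hC₁ : 0 ≤ C₁)
    (hC₂ : C₂ = κ * C₁) (hC₃ : C₃ = κ ^ 2 * C₁) (hC₄ : C₄ = κ ^ 3 * C₁)
    (hD₁ : 0 ≤ D₁) (hD₂ : 0 ≤ D₂) (hw₁ : 0 ≤ W₁) (hw₂ : 0 ≤ W₂)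
    (hrel₁ : W₁ ≤ ω₁ * W₀) (hrel₂ : W₂ ≤ ω₂ * W₀) (hrel₃ : W₃ ≤ ω₃ * W₀)
    (hB₀ : B₀ = C₁ * W₀) (hB₁ : B₁ = C₂ * W₀ * (D₁ + W₁) + C₁ * W₁)
    (hB₂ : B₂ = C₃ * W₀ * (D₁ + W₁) ^ 2 + C₂ * (W₁ * (2 * D₁ + W₁)) + (C₂ * W₀ * (D₂ + W₂) + C₁ * W₂))
    (hB₃ : B₃ = C₄ * W₀ * (D₁ + W₁) ^ 3 + C₃ * (W₁ * (3 * D₁ ^ 2 + 3 * D₁ * W₁ + W₁ ^ 2)) +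
        3 * (C₃ * W₀ * ((D₁ + W₁) * (D₂ + W₂)) + C₂ * (D₁ * W₂ + W₁ * D₂ + W₁ * W₂)) + (C₂ * W₀ * (D₃ + W₃) + C₁ * W₃)) :
    B₁ ≤ B₀ * (κ * (D₁ + W₁) + ω₁) ∧
    B₂ ≤ B₀ * (κ ^ 2 * (D₁ + W₁) ^ 2 + κ * (ω₁ * (2 * D₁ + W₁)) + κ * (D₂ + W₂) + ω₂) ∧
    B₃ ≤ B₀ * (κ ^ 3 * (D₁ + W₁) ^ 3 + κ ^ 2 * (ω₁ * (3 * D₁ ^ 2 + 3 * D₁ * W₁ + W₁ ^ 2)) +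
      3 * (κ ^ 2 * ((D₁ + W₁) * (D₂ + W₂)) + κ * (D₁ * ω₂ + ω₁ * D₂ + ω₁ * W₂)) + κ * (D₃ + W₃) + ω₃) := by
  subst hC₂ hC₃ hC₄ hB₀ hB₁ hB₂ hB₃
  -- each `W_k` not multiplied by `W₀` is replaced by `ω_k W₀`; the coefficient in front is nonnegative
  have m₁ : ∀ {c : ℝ}, 0 ≤ c → c * W₁ ≤ c * (ω₁ * W₀) := fun hc => mul_le_mul_of_nonneg_left hrel₁ hc
  have m₂ : ∀ {c : ℝ}, 0 ≤ c → c * W₂ ≤ c * (ω₂ * W₀) := fun hc => mul_le_mul_of_nonneg_left hrel₂ hc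
  have m₃ : ∀ {c : ℝ}, 0 ≤ c → c * W₃ ≤ c * (ω₃ * W₀) := fun hc => mul_le_mul_of_nonneg_left hrel₃ hc
  refine ⟨?_, ?_, ?_⟩
  · have t := m₁ hC₁
    nlinarith [t]
  · have t1 := m₁ (show 0 ≤ κ * C₁ * (2 * D₁ + W₁) by positivity)
    have t2 := m₂ hC₁
    nlinarith [t1, t2]
  · have t1 := m₁ (show 0 ≤ κ ^ 2 * C₁ * (3 * D₁ ^ 2 + 3 * D₁ * W₁ + W₁ ^ 2) by positivity)
    have t2 := m₂ (show 0 ≤ 3 * (κ * C₁) * D₁ by positivity)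
    have t3 := m₁ (show 0 ≤ 3 * (κ * C₁) * D₂ by positivity)
    have t4 := m₁ (show 0 ≤ 3 * (κ * C₁) * W₂ by positivity)
    have t5 := m₃ hC₁
    nlinarith [t1, t2, t3, t4, t5]

end Summit.HubbardSuperconductivity.HubbardSuperconductivity.Theorems.TorusFourierL2

end
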